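import Literature.AlgebraicGeometry.AbelianSchemes.WeilDualityPolarizationTransport   -- ★ (T-W3): `exists_lift_lam`∕`isMonHom_lift`∕`isIso_lift`∕`comp_lift_eq_lift_comp`
import Literature.AlgebraicGeometry.AbelianSchemes.DualPairDimEq                      -- ★ (σ1-g) `DualPair.dim_hat_eq` (+ ★ `WeilPairingIso.exists_weilIso'`, ★ `weilHom_natural`)
import HarnessLib

/-!
# The hermitian Weil duality `e_λ : A[q] ≅ A[q]^D` of a polarization prime to `p` with a Rosati action — over ANY field, `p` ANY prime
# ([Mumford AV] §20 (I) p. 189, §15 Thm. 1; [Tate 1997] §(3.8))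

Topic `Literature/AlgebraicGeometry/AbelianSchemes`; namespace `Literature.AlgebraicGeometry.AbelianSchemes.AbelianSchemeOver.DualPair` (as ★
`WeilDualityPolarizationTransport`).  THEOREMS ONLY (no definition, no named fact, no instance, no notation, no `sorry`).  Cell `hodgecm-mathlib` (D-0151),
F0∕P6 «MOD», line L2 (socket `stub_DOWN`), organ (ρ2′)∕(ρ2″) brick **(W-λ) «THE HERMITIAN DUALITY `e_{pλ}`»** (LA2-plan (g0) RULING «ρ-ROAD v2.1»
2026-09-02T06:01:31Z: bricks CHAR-FREE over a field `k`, `p : ℕ` a prime NOT tied to the characteristic, so that ONE lemma serves the roof kernel UPSTAIRS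
(`Ω̄ ⊇ F_w`, characteristic `0`) and DOWNSTAIRS (`κ̄(w)`, characteristic `p`)).  It is the W-line՚s (W3) «POLARIZATION TRANSPORT» with the Frobenius∕Lagrangian
clause REMOVED and the hypotheses `[PerfectField k] [CharP k p]` of the letter `WeilCartierDualityLagrangian` (`Cruxes/HLiu418/Lines/F0_P6b_WeilCartierDuality.lean`)
DROPPED: the Weil isomorphism ★ `WeilPairingIso.exists_weilIso'` (any field, any prime power `q = p^r`, `hdim` discharged by ★ `DualPair.dim_hat_eq`), its
naturality ★ `WeilPairingHom.weilHom_natural`, the lift `ℓ : G → Ĝ` of `λ|_{A[q]}` (★ `isIso_lift`, ★ `comp_lift_eq_lift_comp` — restated here at an arbitrary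
level `n` because ★ `exists_lift_lam`∕`exists_lift_dual`∕`hermitian_of_natural` carry an idle `[ExpChar k p]` binder).  `--supports stmt-HodgeConjecture-24832`,
count-neutral.  HC_CM is proved only modulo the printed citations (2 remaining named inputs hLiu418 24832, h413 24833) until rung 0 closes; nothing here is about HC.

## Mathematics ([MumfordAV1970] §20 (I) p. 189)

`A∕k` an abelian variety, `D = (Â, 𝒫)` a NORMALISED dual pair (`hD`), `λ : A → Â` a polarization, `q = p^r`; realisations `j : G ↪ A` of `A[q]` and `ĵ : Ĝ ↪ Â` of
`Â[q]` by all `T`-points; `hlam`: `λ|_{A[q]}` kills no non-trivial `T`-point (⟸ `λ ≫ ν = [d]`, `p ∤ d`); labels `O`, bare `star`, `act : O → End A` with layer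
endomorphisms `β a` of `G` over `act a` (`hβ`) and the Rosati adjunction `ι(a†) ≫ λ = λ ≫ ι(a)^∨` (`hRos`).  THEN `e₀ := ℓ ≫ w_A : G ≅ G^D` — `w_A : Ĝ ≅ G^D` the Weil
isomorphism, `ℓ` the lift of `λ|_{A[q]}` (an isomorphism by `hlam` and ranks) — is a homomorphism and HERMITIAN: `β(a†) ≫ e₀ = e₀ ≫ (β a)^D` (`hRos` intertwines
`ℓ` with any lift `βd` of `ι(a)^∨`, naturality intertwines `w_A`).  No `λ^∨ = λ`, no `star ∘ star = id`, no perfectness of `k`, no relation between `p` and `char k`.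

* §1 level-`n` forms of the (T-W3) lift lemmas: `exists_lift_lam_level`, `exists_lift_dual_level`, `hermitian_of_natural_level`.
* §2 **`exists_hermitianDuality_of_polarization`** — THE HEAD: `∃ e₀ : G ≅ G^D, IsMonHom e₀.hom ∧ ∀ a, β (star a) ≫ e₀.hom = e₀.hom ≫ (β a)^D` (the first two
  conjuncts of the W-line letter `WeilCartierDualityLagrangian`, VERBATIM token shapes), + the pairing-value clause `⟪y ≫ e₀, x⟫`-free (consumers use hermitian only).
* §3 (ED. 2) **`exists_hermitianDuality_of_polarization_pairing`** — THE SAME HEAD WITH ITS PAIRING-VALUE CLAUSE on finite points: `⟪y ≫ e₀, x⟫ = e_q(x ≫ j, (y ≫ j) ≫ λ)`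
  (★ `weilChar`), i.e. `e₀` IS `x ↦ e_q(·, λx)` — the clause the ISOTROPY source ★ (ISO-q) `weilUnit_comp_lam_eq_one_of_comp_eq_one` speaks, so that kernels of
  homomorphisms through which `p·λ` descends can be proved isotropic for `e₀` (organ (LAG) of line L2, input `hlagᵢ` of ★ (BLK) `exists_comp_eq_iff_of_lagrangian_of_blocks`).

## References
* [MumfordAV1970] D. Mumford, *Abelian Varieties* (1970), §15 Thm. 1 (p. 143), §20 (I) pp. 186–189.
* [Tate1997FiniteFlatGroupSchemes] J. Tate, *Finite flat group schemes* (1997), §(3.7)–(3.8) pp. 145–146.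
* [GortzWedhorn2020] U. Görtz, T. Wedhorn, *Algebraic Geometry I* (2nd ed. 2020), Definition 4.45 (2), Prop. 12.10.
-/

set_option autoImplicit false

-- Mathlib's `Over`/`Scheme` APIs are stated across semireducible wrappers (as in the ★ `GroupSchemes/*` files).
set_option backward.isDefEq.respectTransparency false

noncomputable section

universe u

open CategoryTheory CategoryTheory.Limits AlgebraicGeometry MonoidalCategory CartesianMonoidalCategory
open scoped MonObj

namespace Literature.AlgebraicGeometry.AbelianSchemes

namespace AbelianSchemeOver

namespace DualPair

open Literature.AlgebraicGeometry.GroupSchemes Literature.AlgebraicGeometry.GroupSchemes.GroupSchemeKernel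
open Literature.AlgebraicGeometry.GroupSchemes.AffineGroupScheme
open Literature.AlgebraicGeometry.Motives Literature.AlgebraicGeometry.Motives.AbelianVariety
open Literature.AlgebraicGeometry.AbelianSchemes.WeilPairing

variable {k : Type u} [Field k]

/-! ## §1 The lift lemmas at an arbitrary level `n` (★ (T-W3) §1–§2 with `p^r` replaced by `n`; proofs verbatim) -/

/-- **The lift `ℓ : G → Ĝ` of `λ|_{A[n]}` EXISTS** (`ℓ ≫ ĵ = j ≫ λ`), any level `n`: `λ` commutes with `[n]` (★ `comp_zsmul_id_hom_eq`).
[cite: MumfordAV1970, §20 p. 186] -/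
theorem exists_lift_lam_level (n : ℕ) (A : AbelianVariety k)
    (D : (AbelianScheme.ofAbelianVariety A).toOver.DualPair) (pol : (AbelianScheme.ofAbelianVariety A).toOver.Polarization D)
    {G : SchemeOver k} [GrpObj G] (j : G ⟶ A.X)
    (hG : ∀ ⦃T : SchemeOver k⦄ (t : T ⟶ A.X), (∃ s : T ⟶ G, s ≫ j = t) ↔ t ≫ ((((n : ℕ) : ℤ) • 𝟙 A).hom.hom.hom) = 1)
    {Ĝ : SchemeOver k} (ĵ : Ĝ ⟶ D.hat.X)
    (hĜ : ∀ ⦃T : SchemeOver k⦄ (t : T ⟶ D.hat.X),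
      (∃ s : T ⟶ Ĝ, s ≫ ĵ = t) ↔ t ≫ ((((n : ℕ) : ℤ) • 𝟙 D.hat.toAffine.toAbelianVariety).hom.hom.hom) = 1) :
    ∃ ℓ : G ⟶ Ĝ, ℓ ≫ ĵ = j ≫ pol.lam := by
  haveI := pol.isMonHom
  refine (hĜ (j ≫ pol.lam)).mpr ?_
  have hj : j ≫ ((((n : ℕ) : ℤ) • 𝟙 A).hom.hom.hom) = 1 := (hG j).mp ⟨𝟙 G, Category.id_comp j⟩
  have e := comp_zsmul_id_hom_eq (A' := (AbelianScheme.ofAbelianVariety A).toOver) (B := D.hat) pol.lam ((n : ℕ) : ℤ)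
  rw [Category.assoc, e, ← Category.assoc]
  change (j ≫ ((((n : ℕ) : ℤ) • 𝟙 A).hom.hom.hom)) ≫ pol.lam = 1
  rw [hj, MonObj.one_comp]

/-- **The dual `f^∨` of an endomorphism lifts to `Ĝ ≅ Â[n]`**, any level `n` (`f^∨` is a homomorphism for a NORMALISED dual pair, ★ `isMonHom_dualIsogenyOver`).
[cite: MumfordAV1970, §15 Thm. 1 (p. 143), §20 p. 186] -/
theorem exists_lift_dual_level (n : ℕ) (A : AbelianVariety k)
    (D : (AbelianScheme.ofAbelianVariety A).toOver.DualPair)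
    (hD : Nonempty ((Scheme.Modules.pullback D.unitHatSlice).obj D.P ≅ SheafOfModules.unit _))
    {Ĝ : SchemeOver k} (ĵ : Ĝ ⟶ D.hat.X)
    (hĜ : ∀ ⦃T : SchemeOver k⦄ (t : T ⟶ D.hat.X),
      (∃ s : T ⟶ Ĝ, s ≫ ĵ = t) ↔ t ≫ ((((n : ℕ) : ℤ) • 𝟙 D.hat.toAffine.toAbelianVariety).hom.hom.hom) = 1)
    (f : A ⟶ A) :
    ∃ βd : Ĝ ⟶ Ĝ, βd ≫ ĵ = ĵ ≫ dualIsogenyOver (A' := (AbelianScheme.ofAbelianVariety A).toOver)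
      (B := (AbelianScheme.ofAbelianVariety A).toOver) f.hom.hom.hom D D := by
  haveI := isMonHom_dualIsogenyOver (A' := (AbelianScheme.ofAbelianVariety A).toOver)
    (B := (AbelianScheme.ofAbelianVariety A).toOver) f.hom.hom.hom D D hD hD
  refine (hĜ _).mpr ?_
  have h : ĵ ≫ ((((n : ℕ) : ℤ) • 𝟙 D.hat.toAffine.toAbelianVariety).hom.hom.hom) = 1 :=
    (hĜ ĵ).mp ⟨𝟙 Ĝ, Category.id_comp ĵ⟩
  have e := comp_zsmul_id_hom_eq (A' := D.hat) (B := D.hat)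
    (dualIsogenyOver (A' := (AbelianScheme.ofAbelianVariety A).toOver) (B := (AbelianScheme.ofAbelianVariety A).toOver)
      f.hom.hom.hom D D) ((n : ℕ) : ℤ)
  rw [Category.assoc, e, ← Category.assoc, h, MonObj.one_comp]

/-- **HERMITIAN**, any level `n`: if `w : Ĝ ≅ G^D` is natural in endomorphisms (`βd ≫ w = w ≫ β^D` for lifts `β` of `f`, `βd` of `f^∨`), then `e₀ := ℓ ≫ w`
satisfies `β(a†) ≫ e₀ = e₀ ≫ (β a)^D` for every `a` — from `hRos a` alone. [cite: MumfordAV1970, §20 (I) (p. 189)] -/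
theorem hermitian_of_natural_level (n : ℕ) (A : AbelianVariety k)
    (D : (AbelianScheme.ofAbelianVariety A).toOver.DualPair)
    (hD : Nonempty ((Scheme.Modules.pullback D.unitHatSlice).obj D.P ≅ SheafOfModules.unit _))
    (pol : (AbelianScheme.ofAbelianVariety A).toOver.Polarization D)
    {G : SchemeOver k} [GrpObj G] [IsCommMonObj G] [IsAffine G.left] [Module.Free k (Alg G)] [Module.Finite k (Alg G)] {j : G ⟶ A.X}
    {Ĝ : SchemeOver k} [GrpObj Ĝ] {ĵ : Ĝ ⟶ D.hat.X} [IsClosedImmersion ĵ.left]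
    (hĜ : ∀ ⦃T : SchemeOver k⦄ (t : T ⟶ D.hat.X),
      (∃ s : T ⟶ Ĝ, s ≫ ĵ = t) ↔ t ≫ ((((n : ℕ) : ℤ) • 𝟙 D.hat.toAffine.toAbelianVariety).hom.hom.hom) = 1)
    (ℓ : G ⟶ Ĝ) (hℓ : ℓ ≫ ĵ = j ≫ pol.lam)
    {O : Type} (star : O → O) (act : O → (A ⟶ A)) (β : O → (G ⟶ G)) [∀ a, IsMonHom (β a)]
    (hβ : ∀ a, β a ≫ j = j ≫ (act a).hom.hom.hom)
    (hRos : ∀ a, (act (star a)).hom.hom.hom ≫ pol.lam =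
      pol.lam ≫ dualIsogenyOver (A' := (AbelianScheme.ofAbelianVariety A).toOver) (B := (AbelianScheme.ofAbelianVariety A).toOver)
        (act a).hom.hom.hom D D)
    (w : Ĝ ≅ cartierDual G)
    (hnat : ∀ (f : A ⟶ A) (β' : G ⟶ G) [IsMonHom β'], β' ≫ j = j ≫ f.hom.hom.hom →
      ∀ (βd : Ĝ ⟶ Ĝ), βd ≫ ĵ = ĵ ≫ dualIsogenyOver (A' := (AbelianScheme.ofAbelianVariety A).toOver)
        (B := (AbelianScheme.ofAbelianVariety A).toOver) f.hom.hom.hom D D → βd ≫ w.hom = w.hom ≫ cartierDualMap β')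
    (a : O) : β (star a) ≫ (ℓ ≫ w.hom) = (ℓ ≫ w.hom) ≫ cartierDualMap (β a) := by
  obtain ⟨βd, hβd⟩ := exists_lift_dual_level n A D hD ĵ hĜ (act a)
  rw [← Category.assoc, comp_lift_eq_lift_comp pol ℓ hℓ star act β hβ hRos a βd hβd, Category.assoc,
    hnat (act a) (β a) (hβ a) βd hβd, Category.assoc]

/-! ## §2 THE HEAD: the hermitian duality `e₀ = ℓ ≫ w_A : A[q] ≅ A[q]^D` (any field, any prime `p`, `q = p^r`) -/

/-- **THE HERMITIAN WEIL DUALITY OF A POLARIZATION PRIME TO `p`.**  Over ANY field `k` and for ANY prime `p` (no relation to `char k`), `q = p^r`: an abelian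
variety `A` with a NORMALISED dual pair `D = (Â, 𝒫)` (`hD`) and a polarization `λ`; realisations `j : G ↪ A` of `A[q]`, `ĵ : Ĝ ↪ Â` of `Â[q]` (all-`T` points,
closed immersions); `hlam` (`λ|_{A[q]}` kills no non-trivial `T`-point — «`deg λ` prime to `p`»); labels `O` with bare `star`, `act : O → End A`, layer endomorphisms
`β a` over `act a` (`hβ`) and the Rosati adjunction `hRos`.  THEN there is an isomorphism of layers `e₀ : G ≅ G^D`, a homomorphism, HERMITIAN: `β(a†) ≫ e₀ = e₀ ≫ (β a)^D`
for every `a` — the first two conjuncts of the W-line letter `WeilCartierDualityLagrangian` without `[PerfectField k] [CharP k p]` and without the Lagrangian clause.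
(`e₀ := ℓ ≫ w_A`: ★ `exists_weilIso'` with `hdim :=` ★ `dim_hat_eq`, ★ `isIso_lift`, §1, ★ `weilHom_natural`.)
[cite: MumfordAV1970, §15 Thm. 1 (p. 143), §20 (I) (pp. 186–189)] [cite: Tate1997FiniteFlatGroupSchemes, §(3.8) p. 145] -/
theorem exists_hermitianDuality_of_polarization (p : ℕ) [Fact p.Prime] (r : ℕ) (A : AbelianVariety k)
    (D : (AbelianScheme.ofAbelianVariety A).toOver.DualPair)
    (hD : Nonempty ((Scheme.Modules.pullback D.unitHatSlice).obj D.P ≅ SheafOfModules.unit _))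
    (pol : (AbelianScheme.ofAbelianVariety A).toOver.Polarization D)
    (G : SchemeOver k) [GrpObj G] [IsCommMonObj G] [IsAffine G.left] [Module.Free k (Alg G)] [Module.Finite k (Alg G)]
    (j : G ⟶ A.X) [IsMonHom j] [IsClosedImmersion j.left]
    (hG : ∀ ⦃T : SchemeOver k⦄ (t : T ⟶ A.X), (∃ s : T ⟶ G, s ≫ j = t) ↔ t ≫ ((((p ^ r : ℕ) : ℤ) • 𝟙 A).hom.hom.hom) = 1)
    (Ĝ : SchemeOver k) [GrpObj Ĝ] [IsCommMonObj Ĝ] [IsAffine Ĝ.left] [Module.Free k (Alg Ĝ)] [Module.Finite k (Alg Ĝ)]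
    (ĵ : Ĝ ⟶ D.hat.X) [IsMonHom ĵ] [IsClosedImmersion ĵ.left]
    (hĜ : ∀ ⦃T : SchemeOver k⦄ (t : T ⟶ D.hat.X),
      (∃ s : T ⟶ Ĝ, s ≫ ĵ = t) ↔ t ≫ ((((p ^ r : ℕ) : ℤ) • 𝟙 D.hat.toAffine.toAbelianVariety).hom.hom.hom) = 1)
    (hlam : ∀ ⦃T : SchemeOver k⦄ (t : T ⟶ G), (t ≫ j) ≫ pol.lam = 1 → t = 1)
    (O : Type) (star : O → O) (act : O → (A ⟶ A)) (β : O → (G ⟶ G)) [∀ a, IsMonHom (β a)]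
    (hβ : ∀ a, β a ≫ j = j ≫ (act a).hom.hom.hom)
    (hRos : ∀ a, (act (star a)).hom.hom.hom ≫ pol.lam =
      pol.lam ≫ dualIsogenyOver (A' := (AbelianScheme.ofAbelianVariety A).toOver) (B := (AbelianScheme.ofAbelianVariety A).toOver)
        (act a).hom.hom.hom D D) :
    ∃ e₀ : G ≅ cartierDual G, IsMonHom e₀.hom ∧ ∀ a : O, β (star a) ≫ e₀.hom = e₀.hom ≫ cartierDualMap (β a) := by
  -- the Weil isomorphism `w : Ĝ ≅ G^D` with its pairing values (any field; `hdim` by ★ `dim_hat_eq`)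
  obtain ⟨w, hwmon, hw⟩ := exists_weilIso' p r A D hD (dim_hat_eq A D) G j hG Ĝ ĵ hĜ
  haveI := hwmon
  -- the lift `ℓ` of `λ|_{A[q]}`: a homomorphism, an isomorphism by `hlam` and ranks
  obtain ⟨ℓ, hℓ⟩ := exists_lift_lam_level (p ^ r) A D pol j hG ĵ hĜ
  haveI := isMonHom_lift pol ℓ hℓ
  haveI := isIso_lift pol hlam ℓ hℓ w
  refine ⟨asIso ℓ ≪≫ w, ?_, fun a => ?_⟩
  · rw [Iso.trans_hom, asIso_hom]
    infer_instance
  · rw [Iso.trans_hom, asIso_hom]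
    exact hermitian_of_natural_level (p ^ r) A D hD pol hĜ ℓ hℓ star act β hβ hRos w
      (fun f β' _ hβ' βd hβd =>
        weilHom_natural (p ^ r) A A D D hD hD f G j hG Ĝ ĵ hĜ G j hG Ĝ ĵ hĜ β' hβ' βd hβd w.hom hw w.hom hw) a

/-! ## §3 (ED. 2) THE HEAD WITH ITS PAIRING-VALUE CLAUSE: `⟪y ≫ e₀, x⟫ = e_q(x ≫ j, (y ≫ j) ≫ λ)` on finite points -/

/-- **THE HERMITIAN WEIL DUALITY OF A POLARIZATION PRIME TO `p`, WITH ITS PAIRING VALUES** (ED. 2, add-only).  Same data and hypotheses as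
`exists_hermitianDuality_of_polarization`; the SAME isomorphism `e₀ := ℓ ≫ w_A : G ≅ G^D` (`ℓ` the lift of `λ|_{A[q]}`, `w_A` the Weil isomorphism ★
`exists_weilIso'`) is a homomorphism, hermitian — `β(a†) ≫ e₀ = e₀ ≫ (β a)^D` —, AND its canonical pairing values on points over FINITE `k`-algebras `T` are
the Weil characters of `λ`: `⟪y ≫ e₀, x⟫ = e_q(x ≫ j, (y ≫ j) ≫ λ)` (★ `weilChar`; the torsion witnesses `hy`, `hx` are quantified, any proofs serve) —
because `⟪y′ ≫ w_A, x⟫ = e_q(x ≫ j, y′ ≫ ĵ)` (★ `exists_weilIso'`) at `y′ := y ≫ ℓ` and `ℓ ≫ ĵ = j ≫ λ`.  This is the clause through which the isotropy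
theorem ★ `weilUnit_comp_lam_eq_one_of_comp_eq_one` ([MumfordAV1970] §23 Thm. 2: the kernel of a homomorphism through which `n·λ` descends is isotropic for
`e_n(·, λ·)`) reaches `e₀` and its two-block cut (★ `exists_twoBlock_hermitianDuality`).
[cite: MumfordAV1970, §15 Thm. 1 (p. 143), §20 (I) (pp. 184–189)] [cite: Tate1997FiniteFlatGroupSchemes, §(3.8) p. 145] -/
theorem exists_hermitianDuality_of_polarization_pairing (p : ℕ) [Fact p.Prime] (r : ℕ) (A : AbelianVariety k)
    (D : (AbelianScheme.ofAbelianVariety A).toOver.DualPair)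
    (hD : Nonempty ((Scheme.Modules.pullback D.unitHatSlice).obj D.P ≅ SheafOfModules.unit _))
    (pol : (AbelianScheme.ofAbelianVariety A).toOver.Polarization D)
    (G : SchemeOver k) [GrpObj G] [IsCommMonObj G] [IsAffine G.left] [Module.Free k (Alg G)] [Module.Finite k (Alg G)]
    (j : G ⟶ A.X) [IsMonHom j] [IsClosedImmersion j.left]
    (hG : ∀ ⦃T : SchemeOver k⦄ (t : T ⟶ A.X), (∃ s : T ⟶ G, s ≫ j = t) ↔ t ≫ ((((p ^ r : ℕ) : ℤ) • 𝟙 A).hom.hom.hom) = 1)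
    (Ĝ : SchemeOver k) [GrpObj Ĝ] [IsCommMonObj Ĝ] [IsAffine Ĝ.left] [Module.Free k (Alg Ĝ)] [Module.Finite k (Alg Ĝ)]
    (ĵ : Ĝ ⟶ D.hat.X) [IsMonHom ĵ] [IsClosedImmersion ĵ.left]
    (hĜ : ∀ ⦃T : SchemeOver k⦄ (t : T ⟶ D.hat.X),
      (∃ s : T ⟶ Ĝ, s ≫ ĵ = t) ↔ t ≫ ((((p ^ r : ℕ) : ℤ) • 𝟙 D.hat.toAffine.toAbelianVariety).hom.hom.hom) = 1)
    (hlam : ∀ ⦃T : SchemeOver k⦄ (t : T ⟶ G), (t ≫ j) ≫ pol.lam = 1 → t = 1)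
    (O : Type) (star : O → O) (act : O → (A ⟶ A)) (β : O → (G ⟶ G)) [∀ a, IsMonHom (β a)]
    (hβ : ∀ a, β a ≫ j = j ≫ (act a).hom.hom.hom)
    (hRos : ∀ a, (act (star a)).hom.hom.hom ≫ pol.lam =
      pol.lam ≫ dualIsogenyOver (A' := (AbelianScheme.ofAbelianVariety A).toOver) (B := (AbelianScheme.ofAbelianVariety A).toOver)
        (act a).hom.hom.hom D D) :
    ∃ e₀ : G ≅ cartierDual G, IsMonHom e₀.hom ∧ (∀ a : O, β (star a) ≫ e₀.hom = e₀.hom ≫ cartierDualMap (β a)) ∧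
      ∀ ⦃T : Type u⦄ [CommRing T] [Algebra k T] [Module.Finite k T] (y x : specOver k T ⟶ G)
        (hy : ((y ≫ j) ≫ pol.lam) ^ (p ^ r) = 1) (hx : (x ≫ j) ^ (p ^ r) = 1),
        cartierPairing G (y ≫ e₀.hom) x = D.weilChar hD (p ^ r) ((y ≫ j) ≫ pol.lam) hy (x ≫ j) hx := by
  -- the Weil isomorphism `w : Ĝ ≅ G^D` with its pairing values (any field; `hdim` by ★ `dim_hat_eq`)
  obtain ⟨w, hwmon, hw⟩ := exists_weilIso' p r A D hD (dim_hat_eq A D) G j hG Ĝ ĵ hĜ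
  haveI := hwmon
  -- the lift `ℓ` of `λ|_{A[q]}`: a homomorphism, an isomorphism by `hlam` and ranks
  obtain ⟨ℓ, hℓ⟩ := exists_lift_lam_level (p ^ r) A D pol j hG ĵ hĜ
  haveI := isMonHom_lift pol ℓ hℓ
  haveI := isIso_lift pol hlam ℓ hℓ w
  refine ⟨asIso ℓ ≪≫ w, ?_, fun a => ?_, fun T _ _ _ y x hy hx => ?_⟩
  · rw [Iso.trans_hom, asIso_hom]
    infer_instance
  · rw [Iso.trans_hom, asIso_hom]
    exact hermitian_of_natural_level (p ^ r) A D hD pol hĜ ℓ hℓ star act β hβ hRos w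
      (fun f β' _ hβ' βd hβd =>
        weilHom_natural (p ^ r) A A D D hD hD f G j hG Ĝ ĵ hĜ G j hG Ĝ ĵ hĜ β' hβ' βd hβd w.hom hw w.hom hw) a
  · -- `⟪y ≫ ℓ ≫ w, x⟫ = e_q(x ≫ j, (y ≫ ℓ) ≫ ĵ) = e_q(x ≫ j, (y ≫ j) ≫ λ)`
    rw [Iso.trans_hom, asIso_hom, ← Category.assoc, hw (y ≫ ℓ) x]
    exact D.weilChar_congr hD (p ^ r) (by rw [Category.assoc, hℓ, Category.assoc]) _ hy rfl _ hx

end DualPair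

end AbelianSchemeOver

end Literature.AlgebraicGeometry.AbelianSchemes

end
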